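import Literature.NumberTheory.LFunctions.SchoenfeldZeroSums
import HarnessLib

/-!
# HANDOFF — the LOGARITHMIC POTENTIAL of the killed zeros against the lattice, by partial summation: `Π_ρ((γ+1)² − γ_ρ²)^{m(ρ)} ≤ Π_k((γ+1)² − ℓ_k²)·exp(−(2/(γ+1)²)∫_0^T t·D(t)dt)` (rh-explicit, track «HANDOFF», seat prove-2 gen9, ATTEMPT-18 (D-4): Lemma C2 FAR and NEAR unified)

HONEST FRAMING. Nothing here bears on the truth of RH; this is zero COUNTING. ATTEMPT-16 (HOME/handoff/prove-2/ATTEMPT-16.md §4) bounds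
the dodger's transform `E(z) = c_∞·(sin bz/(bz))·Π_k(z² − z_k²)/(z² − ℓ_k²)` at an unkilled zero `z = γ + iη` in two zones (C2 FAR / NEAR),
through a PAIRING `k ↦ (z_k, ℓ_k)` of killed zeros with lattice points. ATTEMPT-18 (D-4) removes the pairing and the zones: with the killed
multiset `zerosBetween 0 T` (`K := N(T)`, `ℓ_k = πk/b`, `ℓ_K ≤ T`, counting function `Λ(t) = min(⌊bt/π⌋, K)`), for ANY `f ∈ C¹[0, T]`

  `Σ_ρ m(ρ)f(Im ρ) − Σ_{k≤K} f(ℓ_k) = −∫_0^T (N(t) − Λ(t))·f′(t) dt`   (`sum_zeros_sub_sum_lattice_eq`),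

and the clean horizon (tree `HandoffDodgerCleanHorizon`: `N(ℓ_k) ≤ k − 1`) gives `N ≤ Λ` on `[0, T]`, indeed `N − Λ ≤ −D` with
`D = (deficit − s − 1)⁺`; so for `f′ ≤ 0`:  `Σ_ρ m f(γ_ρ) − Σ_k f(ℓ_k) ≤ −∫_0^T D·(−f′)`  (`sum_zeros_sub_sum_lattice_le`). With
`f(t) = log((γ+1)² − t²)` (`−f′ = 2t/((γ+1)² − t²) ≥ 2t/(γ+1)²`) this is the potential bound

  `Π_{ρ ∈ zerosBetween 0 T} ((γ+1)² − (Im ρ)²)^{m(ρ)} ≤ Π_{k<K}((γ+1)² − ℓ_{k+1}²) · exp(−(2/(γ+1)²)·∫_0^T t·D(t) dt)`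

(`prod_killed_le_prod_lattice_mul_exp`) valid at EVERY height `γ > T` — near or far — and since `|z² − z_ρ²| ≤ (γ+1)² − γ_ρ²` for
`|η|, |η_ρ| ≤ ½` (`norm_sq_sub_sq_le`), it bounds the numerator of `|E(z)|` with no enumeration of the zeros. No `sorry`, standard axioms,
no definitions.

References: this track (ATTEMPT-16 §4; ATTEMPT-18 §1 (D-2), (D-4)). J. B. Rosser, L. Schoenfeld, Math. Comp. 29 (1975), Lemma 7
(partial summation against `N`; tree `SchoenfeldBound.sum_zerosBetween_eq`).
-/

set_option linter.dupNamespace false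

noncomputable section

open Real Finset MeasureTheory intervalIntegral Complex

namespace Summit.RiemannHypothesis.RiemannHypothesis.Theorems.Handoff

open Literature.NumberTheory.LFunctions Literature.NumberTheory.LFunctions.SchoenfeldBound

/-! ## Partial summation of the lattice against its counting function -/

/-- **Partial summation of the lattice**: for `b > 0`, `T ≥ πK/b` and `f` with continuous derivative `f′` on `[0, T]`,
`Σ_{k<K} f(π(k+1)/b) = K·f(T) − ∫_0^T min(⌊bt/π⌋, K)·f′(t) dt`. [folklore] -/
theorem sum_lattice_eq {b T : ℝ} (hb : 0 < b) {K : ℕ} (hT : π * K / b ≤ T) {f f' : ℝ → ℝ}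
    (hf : ∀ t ∈ Set.Icc 0 T, HasDerivAt f (f' t) t) (hf' : ContinuousOn f' (Set.Icc 0 T)) :
    ∑ k ∈ Finset.range K, f (π * ((k + 1 : ℕ) : ℝ) / b) =
      (K : ℝ) * f T - ∫ t in (0 : ℝ)..T, ((min ⌊b * t / π⌋₊ K : ℕ) : ℝ) * f' t := by
  classical
  have hT0 : 0 ≤ T := le_trans (by positivity) hT
  -- each lattice value as `f(T) − ∫_0^T 1_{ℓ_k ≤ t} f′`
  have hk : ∀ k ∈ Finset.range K, f (π * ((k + 1 : ℕ) : ℝ) / b) =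
      f T - ∫ t in (0 : ℝ)..T, (if π * ((k + 1 : ℕ) : ℝ) / b ≤ t then (1 : ℝ) else 0) * f' t := by
    intro k hk
    have hℓ0 : 0 < π * ((k + 1 : ℕ) : ℝ) / b := by positivity
    have hℓT : π * ((k + 1 : ℕ) : ℝ) / b ≤ T := by
      refine le_trans ?_ hT
      have : ((k + 1 : ℕ) : ℝ) ≤ K := by exact_mod_cast Finset.mem_range.1 hk
      exact div_le_div_of_nonneg_right (mul_le_mul_of_nonneg_left this Real.pi_pos.le) hb.le
    rw [integral_indicator_mul_eq hℓ0 hℓT hf']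
    have hderiv : ∀ t ∈ Set.uIcc (π * ((k + 1 : ℕ) : ℝ) / b) T, HasDerivAt f (f' t) t := fun t ht => by
      rw [Set.uIcc_of_le hℓT] at ht
      exact hf t ⟨hℓ0.le.trans ht.1, ht.2⟩
    have hint : IntervalIntegrable f' volume (π * ((k + 1 : ℕ) : ℝ) / b) T :=
      (hf'.mono (Set.Icc_subset_Icc hℓ0.le le_rfl)).intervalIntegrable_of_Icc hℓT
    rw [integral_eq_sub_of_hasDerivAt hderiv hint]
    ring
  rw [Finset.sum_congr rfl hk, Finset.sum_sub_distrib, Finset.sum_const, Finset.card_range, nsmul_eq_mul]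
  have hg' : IntegrableOn f' (Set.Ioc 0 T) volume := hf'.integrableOn_Icc.mono_set Set.Ioc_subset_Icc_self
  have hint : ∀ k ∈ Finset.range K, IntervalIntegrable
      (fun t => (if π * ((k + 1 : ℕ) : ℝ) / b ≤ t then (1 : ℝ) else 0) * f' t) volume 0 T := by
    intro k _
    have heq : (fun t => (if π * ((k + 1 : ℕ) : ℝ) / b ≤ t then (1 : ℝ) else 0) * f' t) =
        (Set.Ici (π * ((k + 1 : ℕ) : ℝ) / b)).indicator f' := by
      funext t
      by_cases h : π * ((k + 1 : ℕ) : ℝ) / b ≤ t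
      · rw [if_pos h, one_mul, Set.indicator_of_mem (show t ∈ Set.Ici _ from h)]
      · rw [if_neg h, zero_mul, Set.indicator_of_notMem (show t ∉ Set.Ici _ from h)]
    rw [intervalIntegrable_iff_integrableOn_Ioc_of_le hT0, heq]
    exact hg'.indicator measurableSet_Ici
  -- the lattice counting function: `#{k < K : π(k+1)/b ≤ t} = min(⌊bt/π⌋, K)` (as in `HandoffDodgerMoments.card_lattice_le`)
  have hcard : ∀ t : ℝ, 0 ≤ t →
      ((Finset.range K).filter fun k : ℕ => π * ((k + 1 : ℕ) : ℝ) / b ≤ t).card = min ⌊b * t / π⌋₊ K := by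
    intro t ht
    have hbt : 0 ≤ b * t / π := by positivity
    have hiff : ∀ k : ℕ, π * ((k + 1 : ℕ) : ℝ) / b ≤ t ↔ k < ⌊b * t / π⌋₊ := by
      intro k
      rw [← Nat.add_one_le_iff, Nat.le_floor_iff hbt, div_le_iff₀ hb, le_div_iff₀ Real.pi_pos]
      push_cast
      constructor <;> intro h <;> nlinarith [Real.pi_pos]
    have e : (Finset.range K).filter (fun k : ℕ => π * ((k + 1 : ℕ) : ℝ) / b ≤ t) =
        (Finset.range K).filter (fun k : ℕ => k < ⌊b * t / π⌋₊) := Finset.filter_congr fun k _ => hiff k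
    rw [e, Finset.range_eq_Ico, Finset.Ico_filter_lt, Nat.card_Ico, Nat.sub_zero, min_comm]
  rw [← integral_finsetSum hint]
  congr 1
  refine integral_congr fun t ht => ?_
  rw [Set.uIcc_of_le hT0] at ht
  rw [← Finset.sum_mul, Finset.sum_boole, hcard t ht.1]

/-! ## The general identity and the sign lemma -/

/-- **Killed zeros minus lattice, general weight (kernel).** For `b > 0`, `T ≥ 0`, `K := N(T)` with `πK/b ≤ T`, and `f ∈ C¹[0, T]`:
`Σ_{ρ ∈ zerosBetween 0 T} m(ρ)f(Im ρ) − Σ_{k<K} f(π(k+1)/b) = −∫_0^T (N(t) − min(⌊bt/π⌋, K))·f′(t) dt`. [this track, ATTEMPT-18 (D-4)] -/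
theorem sum_zeros_sub_sum_lattice_eq {b T : ℝ} (hb : 0 < b) (hT : 0 ≤ T) (hK : π * (zetaZeroCount T) / b ≤ T)
    {f f' : ℝ → ℝ} (hf : ∀ t ∈ Set.Icc 0 T, HasDerivAt f (f' t) t) (hf' : ContinuousOn f' (Set.Icc 0 T)) :
    (∑ ρ ∈ zerosBetween 0 T, (riemannZetaZeroOrder ρ : ℝ) * f ρ.im) -
        ∑ k ∈ Finset.range (zetaZeroCount T), f (π * ((k + 1 : ℕ) : ℝ) / b) =
      -∫ t in (0 : ℝ)..T, ((zetaZeroCount t : ℝ) - ((min ⌊b * t / π⌋₊ (zetaZeroCount T) : ℕ) : ℝ)) * f' t := by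
  rw [sum_zerosBetween_eq le_rfl hT hf hf', sum_lattice_eq hb hK hf hf']
  simp only [zetaZeroCount_eq_zero_of_nonpos le_rfl, Nat.cast_zero, sub_zero]
  have hIcc : Set.uIcc 0 T = Set.Icc 0 T := Set.uIcc_of_le hT
  have hN : IntervalIntegrable (fun t : ℝ => (zetaZeroCount t : ℝ) * f' t) volume 0 T := by
    have := intervalIntegrable_count_sub_mul (T₁ := 0) (a := 0) (b := T) (g := f') (by rw [hIcc]; exact hf')
    simpa [zetaZeroCount_eq_zero_of_nonpos le_rfl] using this
  have hΛ0 : IntervalIntegrable (fun t : ℝ => (((min ⌊b * t / π⌋₊ (zetaZeroCount T) : ℕ) : ℝ))) volume 0 T := by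
    refine Monotone.intervalIntegrable fun s t hst => ?_
    exact_mod_cast min_le_min_right _ (Nat.floor_le_floor (by
      exact div_le_div_of_nonneg_right (mul_le_mul_of_nonneg_left hst hb.le) Real.pi_pos.le))
  have hΛ : IntervalIntegrable (fun t : ℝ => (((min ⌊b * t / π⌋₊ (zetaZeroCount T) : ℕ) : ℝ)) * f' t) volume 0 T :=
    hΛ0.mul_continuousOn (by rw [hIcc]; exact hf')
  have e : ∫ t in (0 : ℝ)..T, ((zetaZeroCount t : ℝ) - ((min ⌊b * t / π⌋₊ (zetaZeroCount T) : ℕ) : ℝ)) * f' t =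
      (∫ t in (0 : ℝ)..T, (zetaZeroCount t : ℝ) * f' t) -
        ∫ t in (0 : ℝ)..T, (((min ⌊b * t / π⌋₊ (zetaZeroCount T) : ℕ) : ℝ)) * f' t := by
    rw [← intervalIntegral.integral_sub hN hΛ]
    refine integral_congr fun t _ => ?_
    ring
  rw [e]
  ring

/-- **The sign lemma.** If moreover `N(t) − min(⌊bt/π⌋, K) ≤ −D(t)` on `[0, T]` (`D` continuous; e.g. `D = (deficit − s − 1)⁺` from the clean
horizon) and `f′ ≤ 0` on `[0, T]`, then `Σ_ρ m(ρ)f(Im ρ) − Σ_{k<K} f(ℓ_{k+1}) ≤ −∫_0^T D(t)·(−f′(t)) dt`. [this track, ATTEMPT-18 (D-4)] -/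
theorem sum_zeros_sub_sum_lattice_le {b T : ℝ} (hb : 0 < b) (hT : 0 ≤ T) (hK : π * (zetaZeroCount T) / b ≤ T)
    {f f' : ℝ → ℝ} (hf : ∀ t ∈ Set.Icc 0 T, HasDerivAt f (f' t) t) (hf' : ContinuousOn f' (Set.Icc 0 T))
    (hf'0 : ∀ t ∈ Set.Icc 0 T, f' t ≤ 0) {D : ℝ → ℝ} (hD : ContinuousOn D (Set.Icc 0 T))
    (hΔ : ∀ t ∈ Set.Icc 0 T, (zetaZeroCount t : ℝ) - ((min ⌊b * t / π⌋₊ (zetaZeroCount T) : ℕ) : ℝ) ≤ -D t) :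
    (∑ ρ ∈ zerosBetween 0 T, (riemannZetaZeroOrder ρ : ℝ) * f ρ.im) -
        ∑ k ∈ Finset.range (zetaZeroCount T), f (π * ((k + 1 : ℕ) : ℝ) / b) ≤
      -∫ t in (0 : ℝ)..T, D t * (-f' t) := by
  rw [sum_zeros_sub_sum_lattice_eq hb hT hK hf hf', neg_le_neg_iff]
  have hIcc : Set.uIcc 0 T = Set.Icc 0 T := Set.uIcc_of_le hT
  have hN : IntervalIntegrable (fun t : ℝ => (zetaZeroCount t : ℝ)) volume 0 T :=
    Monotone.intervalIntegrable fun s t hst => by exact_mod_cast zetaZeroCount_mono hst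
  have hΛ : IntervalIntegrable (fun t : ℝ => (((min ⌊b * t / π⌋₊ (zetaZeroCount T) : ℕ) : ℝ))) volume 0 T := by
    refine Monotone.intervalIntegrable fun s t hst => ?_
    exact_mod_cast min_le_min_right _ (Nat.floor_le_floor (by
      exact div_le_div_of_nonneg_right (mul_le_mul_of_nonneg_left hst hb.le) Real.pi_pos.le))
  refine integral_mono_on hT ((hD.mul hf'.neg).intervalIntegrable_of_Icc hT)
    ((hN.sub hΛ).mul_continuousOn (by rw [hIcc]; exact hf')) fun t ht => ?_
  have h1 := hΔ t ht
  have h2 := hf'0 t ht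
  nlinarith

/-! ## The logarithmic potential -/

/-- **The potential bound (sum form).** For `γ` with `T < γ + 1` (e.g. any `γ > T`), `f(t) = log((γ+1)² − t²)`:
`Σ_ρ m(ρ)·log((γ+1)² − (Im ρ)²) − Σ_{k<K} log((γ+1)² − ℓ_{k+1}²) ≤ −(2/(γ+1)²)·∫_0^T t·D(t) dt` under the hypotheses of the sign lemma
with `D ≥ 0`. [this track, ATTEMPT-18 (D-4)] -/
theorem sum_log_killed_sub_sum_log_lattice_le {b T γ : ℝ} (hb : 0 < b) (hT : 0 ≤ T) (hγ : T < γ + 1)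
    (hK : π * (zetaZeroCount T) / b ≤ T) {D : ℝ → ℝ} (hD : ContinuousOn D (Set.Icc 0 T)) (hD0 : ∀ t ∈ Set.Icc 0 T, 0 ≤ D t)
    (hΔ : ∀ t ∈ Set.Icc 0 T, (zetaZeroCount t : ℝ) - ((min ⌊b * t / π⌋₊ (zetaZeroCount T) : ℕ) : ℝ) ≤ -D t) :
    (∑ ρ ∈ zerosBetween 0 T, (riemannZetaZeroOrder ρ : ℝ) * Real.log ((γ + 1) ^ 2 - ρ.im ^ 2)) -
        ∑ k ∈ Finset.range (zetaZeroCount T), Real.log ((γ + 1) ^ 2 - (π * ((k + 1 : ℕ) : ℝ) / b) ^ 2) ≤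
      -(2 / (γ + 1) ^ 2 * ∫ t in (0 : ℝ)..T, t * D t) := by
  have hpos : ∀ t ∈ Set.Icc 0 T, 0 < (γ + 1) ^ 2 - t ^ 2 := fun t ht => by
    have : t < γ + 1 := lt_of_le_of_lt ht.2 hγ
    nlinarith [ht.1]
  -- `f(t) = log((γ+1)² − t²)`, `f′(t) = −2t/((γ+1)² − t²)`
  have hf : ∀ t ∈ Set.Icc 0 T, HasDerivAt (fun u : ℝ => Real.log ((γ + 1) ^ 2 - u ^ 2))
      (-(2 * t) / ((γ + 1) ^ 2 - t ^ 2)) t := by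
    intro t ht
    have h1 : HasDerivAt (fun u : ℝ => (γ + 1) ^ 2 - u ^ 2) (-(2 * t)) t := by
      simpa using ((hasDerivAt_pow 2 t).const_sub ((γ + 1) ^ 2))
    exact h1.log (hpos t ht).ne'
  have hf' : ContinuousOn (fun t : ℝ => -(2 * t) / ((γ + 1) ^ 2 - t ^ 2)) (Set.Icc 0 T) := by
    refine ContinuousOn.div (by fun_prop) (by fun_prop) fun t ht => (hpos t ht).ne'
  have hf'0 : ∀ t ∈ Set.Icc 0 T, -(2 * t) / ((γ + 1) ^ 2 - t ^ 2) ≤ 0 := fun t ht =>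
    div_nonpos_of_nonpos_of_nonneg (by linarith [ht.1]) (hpos t ht).le
  have h := sum_zeros_sub_sum_lattice_le hb hT hK hf hf' hf'0 hD hΔ
  refine h.trans ?_
  rw [neg_le_neg_iff, ← intervalIntegral.integral_const_mul]
  refine integral_mono_on hT ((by fun_prop : Continuous fun t : ℝ => t).continuousOn.mul hD
      |>.intervalIntegrable_of_Icc hT |>.const_mul _) ((hD.mul hf'.neg).intervalIntegrable_of_Icc hT) fun t ht => ?_
  -- `(2/(γ+1)²)·t·D ≤ D·(2t/((γ+1)² − t²))`
  have hp := hpos t ht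
  have hDt := hD0 t ht
  rw [neg_div, neg_neg]
  have h3 : 2 / (γ + 1) ^ 2 * (t * D t) = D t * (2 * t / (γ + 1) ^ 2) := by ring
  rw [h3]
  refine mul_le_mul_of_nonneg_left ?_ hDt
  refine div_le_div_of_nonneg_left (by linarith [ht.1]) hp ?_
  nlinarith [ht.1]

/-- **The potential bound (product form).** Under the same hypotheses:
`Π_{ρ ∈ zerosBetween 0 T} ((γ+1)² − (Im ρ)²)^{m(ρ)} ≤ Π_{k<K} ((γ+1)² − ℓ_{k+1}²) · exp(−(2/(γ+1)²)∫_0^T t·D(t)dt)` — the numerator of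
`|E(z)|` at ANY unkilled height `γ > T`, near or far, with no pairing of zeros and lattice points. [this track, ATTEMPT-18 (D-4)] -/
theorem prod_killed_le_prod_lattice_mul_exp {b T γ : ℝ} (hb : 0 < b) (hT : 0 ≤ T) (hγ : T < γ + 1)
    (hK : π * (zetaZeroCount T) / b ≤ T) {D : ℝ → ℝ} (hD : ContinuousOn D (Set.Icc 0 T)) (hD0 : ∀ t ∈ Set.Icc 0 T, 0 ≤ D t)
    (hΔ : ∀ t ∈ Set.Icc 0 T, (zetaZeroCount t : ℝ) - ((min ⌊b * t / π⌋₊ (zetaZeroCount T) : ℕ) : ℝ) ≤ -D t) :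
    ∏ ρ ∈ zerosBetween 0 T, ((γ + 1) ^ 2 - ρ.im ^ 2) ^ riemannZetaZeroOrder ρ ≤
      (∏ k ∈ Finset.range (zetaZeroCount T), ((γ + 1) ^ 2 - (π * ((k + 1 : ℕ) : ℝ) / b) ^ 2)) *
        Real.exp (-(2 / (γ + 1) ^ 2 * ∫ t in (0 : ℝ)..T, t * D t)) := by
  have h := sum_log_killed_sub_sum_log_lattice_le hb hT hγ hK hD hD0 hΔ
  -- positivity of all bases
  have hzpos : ∀ ρ ∈ zerosBetween 0 T, 0 < (γ + 1) ^ 2 - ρ.im ^ 2 := fun ρ hρ => by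
    have h4 := ((mem_zerosBetween le_rfl).1 hρ).2.2.2
    have : ρ.im < γ + 1 := lt_of_le_of_lt h4.2 hγ
    nlinarith [h4.1]
  have hlpos : ∀ k ∈ Finset.range (zetaZeroCount T), 0 < (γ + 1) ^ 2 - (π * ((k + 1 : ℕ) : ℝ) / b) ^ 2 := fun k hk => by
    have hℓ0 : 0 < π * ((k + 1 : ℕ) : ℝ) / b := by positivity
    have hℓT : π * ((k + 1 : ℕ) : ℝ) / b ≤ T := by
      refine le_trans ?_ hK
      have : ((k + 1 : ℕ) : ℝ) ≤ zetaZeroCount T := by exact_mod_cast Finset.mem_range.1 hk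
      exact div_le_div_of_nonneg_right (mul_le_mul_of_nonneg_left this Real.pi_pos.le) hb.le
    have : π * ((k + 1 : ℕ) : ℝ) / b < γ + 1 := lt_of_le_of_lt hℓT hγ
    nlinarith
  -- exponentiate
  have e1 : ∏ ρ ∈ zerosBetween 0 T, ((γ + 1) ^ 2 - ρ.im ^ 2) ^ riemannZetaZeroOrder ρ =
      Real.exp (∑ ρ ∈ zerosBetween 0 T, (riemannZetaZeroOrder ρ : ℝ) * Real.log ((γ + 1) ^ 2 - ρ.im ^ 2)) := by
    rw [Real.exp_sum]
    refine Finset.prod_congr rfl fun ρ hρ => ?_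
    rw [← Real.rpow_intCast, Real.rpow_def_of_pos (hzpos ρ hρ), mul_comm]
  have e2 : ∏ k ∈ Finset.range (zetaZeroCount T), ((γ + 1) ^ 2 - (π * ((k + 1 : ℕ) : ℝ) / b) ^ 2) =
      Real.exp (∑ k ∈ Finset.range (zetaZeroCount T), Real.log ((γ + 1) ^ 2 - (π * ((k + 1 : ℕ) : ℝ) / b) ^ 2)) := by
    rw [Real.exp_sum]
    exact Finset.prod_congr rfl fun k hk => (Real.exp_log (hlpos k hk)).symm
  rw [e1, e2, ← Real.exp_add]
  exact Real.exp_le_exp.2 (by linarith)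

/-- The numerator of a far/near factor: for `z = γ + iη`, `z' = γ' + iη'` with `|η|, |η'| ≤ ½` and `0 ≤ γ' ≤ γ`:
`‖z² − z'²‖ ≤ (γ+1)² − γ'²` (`= (γ − γ' + 1)(γ + γ' + 1)`). [this track, ATTEMPT-18 (D-4)] -/
theorem norm_sq_sub_sq_le {γ η γ' η' : ℝ} (hη : |η| ≤ 1 / 2) (hη' : |η'| ≤ 1 / 2) (hγ' : 0 ≤ γ') (hle : γ' ≤ γ) :
    ‖((γ : ℂ) + η * I) ^ 2 - ((γ' : ℂ) + η' * I) ^ 2‖ ≤ (γ + 1) ^ 2 - γ' ^ 2 := by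
  have e : ((γ : ℂ) + η * I) ^ 2 - ((γ' : ℂ) + η' * I) ^ 2 =
      (((γ - γ' : ℝ) : ℂ) + ((η - η' : ℝ) : ℂ) * I) * (((γ + γ' : ℝ) : ℂ) + ((η + η' : ℝ) : ℂ) * I) := by
    push_cast; ring
  rw [e, norm_mul]
  have hηη1 : |η - η'| ≤ 1 := (abs_sub η η').trans (by linarith)
  have hηη2 : |η + η'| ≤ 1 := (abs_add_le η η').trans (by linarith)
  have h1 : ‖(((γ - γ' : ℝ) : ℂ) + ((η - η' : ℝ) : ℂ) * I)‖ ≤ γ - γ' + 1 := by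
    refine (norm_add_le _ _).trans ?_
    rw [Complex.norm_real, norm_mul, Complex.norm_real, Complex.norm_I, mul_one, Real.norm_eq_abs, Real.norm_eq_abs,
      abs_of_nonneg (by linarith : (0 : ℝ) ≤ γ - γ')]
    linarith
  have h2 : ‖(((γ + γ' : ℝ) : ℂ) + ((η + η' : ℝ) : ℂ) * I)‖ ≤ γ + γ' + 1 := by
    refine (norm_add_le _ _).trans ?_
    rw [Complex.norm_real, norm_mul, Complex.norm_real, Complex.norm_I, mul_one, Real.norm_eq_abs, Real.norm_eq_abs,
      abs_of_nonneg (by linarith : (0 : ℝ) ≤ γ + γ')]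
    linarith
  calc ‖(((γ - γ' : ℝ) : ℂ) + ((η - η' : ℝ) : ℂ) * I)‖ * ‖(((γ + γ' : ℝ) : ℂ) + ((η + η' : ℝ) : ℂ) * I)‖
      ≤ (γ - γ' + 1) * (γ + γ' + 1) := mul_le_mul h1 h2 (norm_nonneg _) (by linarith)
    _ = (γ + 1) ^ 2 - γ' ^ 2 := by ring

end Summit.RiemannHypothesis.RiemannHypothesis.Theorems.Handoff

end
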